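import Summits.CriticalPhenomena.Ising3DConformalLimit.Theses.CanonicalBranchRefutation
import Literature.Probability.LatticeModels.PointwiseScalingLimitEtaExists
import HarnessLib

/-!
# Messager–Miracle-Solé de-averaging of the critical sphere masses on `ℤ³`
(route `CanonicalBranchRefutation`, crux item stmt-CriticalPhenomena-15521 `InfraredExponentZero`,
line `registered`, stub `stub_sphereMass_deaveraging`)

THEOREM-ONLY file (no definitions, no named facts). For the critical plus-state two-point function
`G := criticalTwoPoint 3 = ⟨σ₀σ_x⟩⁺_{β_c}` of the nearest-neighbour Ising model on `ℤ³` and the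
sup-norm shells `∂Λ_n = sphere 3 n = {y : ‖y‖_∞ = n}`:

* `card_sphere_three_mul_le` — the shell count `#∂Λ_{3m} ≤ 294 m²` for `m ≥ 1`
  (`#∂Λ_{k+1} ≤ 6 (2k+3)²`, tree `card_sphere_succ_le`, at `k = 3m - 1`);
* `stub_sphereMass_deaveraging` — **de-averaging**: there is `c > 0` (here `c = 1/294`) with
  `c ‖x‖_∞⁻² ∑_{y ∈ ∂Λ_{3‖x‖_∞}} G(y) ≤ G(x)` for every `x ≠ 0`.

Proof: the Messager–Miracle-Solé sphere sandwich `G(3n e₁) ≤ G(y) ≤ G(n e₁)` for `‖y‖_∞ = n ≥ 1`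
(tree `criticalTwoPoint_axis_sandwich`, Duminil-Copin 2019, §4.3 Exercise 37 (4), eq. (4.10),
"(Mes-Mir) used twice") gives, with `m = ‖x‖_∞`, `G(x) ≥ G(3m e₁) ≥ G(y)` for every `y ∈ ∂Λ_{3m}`;
summing over the shell, `∑_{∂Λ_{3m}} G ≤ #∂Λ_{3m} · G(3m e₁) ≤ 294 m² G(x)`.

This is the elementary half of the line `registered` of the crux `InfraredExponentZero`
(`= HasIsingExponentEta 3 0`): it converts sphere-mass growth `∑_{∂Λ_n} G ≥ n^{1-ε}` into the
pointwise lower envelope `G(x) ≥ c_ε ‖x‖^{-(1+ε)}`.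

References: A. Messager, S. Miracle-Solé, J. Stat. Phys. 17 (1977) 245–262
[MessagerMiracleSoleJSP1977]; H. Duminil-Copin, *Lectures on the Ising and Potts models on the
hypercubic lattice* (2019), §4.3, Exercise 37 (4), eq. (4.10) [DuminilCopin2019].
-/

noncomputable section

namespace Summit.CriticalPhenomena.Ising3DConformalLimit.Theorems

open Finset Literature.Probability.LatticeModels

/-- **Shell count on `ℤ³`**: `#∂Λ_{3m} ≤ 294 m²` for `m ≥ 1`, where `∂Λ_n = {y ∈ ℤ³ : ‖y‖_∞ = n}`.
From the tree bound `#∂Λ_{k+1} = (2k+3)³ - (2k+1)³ ≤ 6 (2k+3)²` (`card_sphere_succ_le`) at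
`k = 3m - 1`: `6 (6m+1)² ≤ 6 · 49 m²`. [folklore] -/
theorem card_sphere_three_mul_le {m : ℕ} (hm : 1 ≤ m) :
    (#(sphere 3 (3 * m)) : ℝ) ≤ 294 * (m : ℝ) ^ 2 := by
  obtain ⟨k, hk⟩ : ∃ k : ℕ, 3 * m = k + 1 := ⟨3 * m - 1, by omega⟩
  have hkm : (k : ℝ) + 1 = 3 * (m : ℝ) := by exact_mod_cast hk.symm
  have hm1 : (1 : ℝ) ≤ (m : ℝ) := by exact_mod_cast hm
  have h := card_sphere_succ_le (d := 3) k
  rw [hk]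
  calc (#(sphere 3 (k + 1)) : ℝ) ≤ 2 * ((3 : ℕ) : ℝ) * (2 * k + 3 : ℝ) ^ (3 - 1) := h
    _ = 6 * (6 * (m : ℝ) + 1) ^ 2 := by
        rw [show (2 * k + 3 : ℝ) = 6 * (m : ℝ) + 1 by linarith]
        norm_num
    _ ≤ 294 * (m : ℝ) ^ 2 := by nlinarith

/-- **Messager–Miracle-Solé de-averaging of the critical sphere masses on `ℤ³`** (stub
`stub_sphereMass_deaveraging` of crux item stmt-CriticalPhenomena-15521 `InfraredExponentZero`,
line `registered`): there is `c > 0` such that for every `x ≠ 0` in `ℤ³`, with `m = ‖x‖_∞`,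
`c m⁻² ∑_{y ∈ ∂Λ_{3m}} ⟨σ₀σ_y⟩⁺_{β_c} ≤ ⟨σ₀σ_x⟩⁺_{β_c}`. Indeed `⟨σ₀σ_x⟩ ≥ ⟨σ₀σ_{3m e₁}⟩ ≥ ⟨σ₀σ_y⟩`
for `‖y‖_∞ = 3m` by the MMS sphere sandwich (`criticalTwoPoint_axis_sandwich`, "(Mes-Mir) used
twice"), and `#∂Λ_{3m} ≤ 294 m²` (`card_sphere_three_mul_le`); take `c = 1/294`.
[cite: DuminilCopin2019, §4.3 Exercise 37 (4), eq. (4.10)] [cite: MessagerMiracleSoleJSP1977] -/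
theorem stub_sphereMass_deaveraging :
    ∃ c : ℝ, 0 < c ∧ ∀ x : Site 3, x ≠ 0 →
      c * ((Site.supNorm x : ℝ) ^ 2)⁻¹ * (∑ y ∈ sphere 3 (3 * Site.supNorm x), criticalTwoPoint 3 y)
        ≤ criticalTwoPoint 3 x := by
  refine ⟨1 / 294, by norm_num, fun x hx => ?_⟩
  have hm : 1 ≤ Site.supNorm x := by
    rcases Nat.eq_zero_or_pos (Site.supNorm x) with h | h
    · exact absurd (Site.supNorm_eq_zero_iff.1 h) hx
    · exact h
  -- (i) lower half of the MMS sandwich at `x`: `G(3m e₁) ≤ G(x)`.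
  have hlo : criticalTwoPoint 3 (Pi.single 0 ((3 * Site.supNorm x : ℕ) : ℤ)) ≤ criticalTwoPoint 3 x :=
    (criticalTwoPoint_axis_sandwich hm).1
  -- (ii) upper half at each `y ∈ ∂Λ_{3m}`: `G(y) ≤ G(‖y‖_∞ e₁) = G(3m e₁)`.
  have hterm : ∀ y ∈ sphere 3 (3 * Site.supNorm x),
      criticalTwoPoint 3 y ≤ criticalTwoPoint 3 (Pi.single 0 ((3 * Site.supNorm x : ℕ) : ℤ)) := by
    intro y hy
    have hy' : Site.supNorm y = 3 * Site.supNorm x := mem_sphere.1 hy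
    have hy1 : 1 ≤ Site.supNorm y := by omega
    have h := (criticalTwoPoint_axis_sandwich hy1).2
    rwa [hy'] at h
  have hsum : ∑ y ∈ sphere 3 (3 * Site.supNorm x), criticalTwoPoint 3 y ≤
      (#(sphere 3 (3 * Site.supNorm x)) : ℝ) *
        criticalTwoPoint 3 (Pi.single 0 ((3 * Site.supNorm x : ℕ) : ℤ)) := by
    have h := Finset.sum_le_card_nsmul _ _ _ hterm
    rwa [nsmul_eq_mul] at h
  -- (iii) shell count and (iv) arithmetic.
  have hcard : (#(sphere 3 (3 * Site.supNorm x)) : ℝ) ≤ 294 * (Site.supNorm x : ℝ) ^ 2 :=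
    card_sphere_three_mul_le hm
  have hGpos : 0 < criticalTwoPoint 3 (Pi.single 0 ((3 * Site.supNorm x : ℕ) : ℤ)) :=
    criticalTwoPoint_axis_pos _
  have hmpos : (0 : ℝ) < (Site.supNorm x : ℝ) := by exact_mod_cast hm
  calc 1 / 294 * ((Site.supNorm x : ℝ) ^ 2)⁻¹ *
        (∑ y ∈ sphere 3 (3 * Site.supNorm x), criticalTwoPoint 3 y)
      ≤ 1 / 294 * ((Site.supNorm x : ℝ) ^ 2)⁻¹ * ((#(sphere 3 (3 * Site.supNorm x)) : ℝ) *
          criticalTwoPoint 3 (Pi.single 0 ((3 * Site.supNorm x : ℕ) : ℤ))) :=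
        mul_le_mul_of_nonneg_left hsum (by positivity)
    _ ≤ 1 / 294 * ((Site.supNorm x : ℝ) ^ 2)⁻¹ * (294 * (Site.supNorm x : ℝ) ^ 2 *
          criticalTwoPoint 3 (Pi.single 0 ((3 * Site.supNorm x : ℕ) : ℤ))) :=
        mul_le_mul_of_nonneg_left (mul_le_mul_of_nonneg_right hcard hGpos.le) (by positivity)
    _ = criticalTwoPoint 3 (Pi.single 0 ((3 * Site.supNorm x : ℕ) : ℤ)) := by
        field_simp
    _ ≤ criticalTwoPoint 3 x := hlo

end Summit.CriticalPhenomena.Ising3DConformalLimit.Theorems
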